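import Summits.HodgeConjecture.HodgeConjecture.Theses.LinearSystemTorelli
import Summits.HodgeConjecture.HodgeConjecture.Theses.BoundaryReadout
import Summits.HodgeConjecture.HodgeConjecture.Theses.PeriodDeficiency
import Literature.AlgebraicGeometry.HodgeTheory.HodgeConjectureQbarVoisin
import HarnessLib

/-!
# Route `LinearSystemTorelli` — crux `MiddleDivisorSupportFourfold` (stmt-HodgeConjecture-2409) through
# the absolute-Hodge funnel: two items-only / one-named-fact residues

Helper file for the crux item stmt-HodgeConjecture-2409 (`--supports`; it closes nothing), line
`IdeatorFiveSketch` (idea `weakly-nonfactor-descent`), lead c15.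

The line's registered residue is crux ⟸ T ∧ HC/`ℚ̄`(·,2) modulo two classical named facts
(Riemann's existence theorem in covering form; Voisin II Prop. 4.23 ⟹ Deligne's partie fixe),
T = type stability of `(2,2)` loop-continuations at `ℚ̄`-generic points (the line's transcendence
kernel, OPEN, registered stub `stub_typeStabilityAtQbarGeneric`).  This file puts on the kernel
record WHERE that kernel sits among the NAMED transcendence hypotheses of the field, using only
declarations that already exist in the tree:

* `linearSystemTorelli_middleDivisorSupportFourfold_of_absoluteHodge_of_absoluteReduction` —
  **items only**: crux ⟸ AH(4,2) ∧ `BoundaryReadout.HCOverNumberFields` (stmt-HodgeConjecture-1070)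
  ∧ `BoundaryReadout.AbsoluteReduction` (stmt-HodgeConjecture-15945 = Voisin 2007 Prop. 1.2, a
  THEOREM IN PRINT carried as a route item), where AH(4,2) — "every rational `(2,2)`-class on a smooth
  projective complex fourfold is an absolute Hodge class" (Deligne's question, `IsAbsoluteHodgeClass`)
  — is stated inline as the hypothesis;
* `linearSystemTorelli_middleDivisorSupportFourfold_of_weaklyAbsoluteHodge_of_voisin2007` —
  **one named fact**: crux ⟸ WAH(4,2) ∧ `PeriodDeficiency.HodgeConjectureQbar` (stmt-11596) modulo
  the Literature named fact `voisin2007_hodgeConjecture_weaklyAbsolute_of_qbar` (Voisin 2007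
  Prop. 1.2, weakly-absolute reading), WAH(4,2) — "every rational `(2,2)`-class on a smooth projective
  complex fourfold is WEAKLY absolute Hodge" (Voisin 2007 Def. 2.1, `IsWeaklyAbsoluteHodgeClass`) —
  stated inline;
* `linearSystemTorelli_middleDivisorSupportFourfold_of_absoluteHodge_of_voisin2007` — the same with
  AH(4,2) (absolute ⟹ weakly absolute, `IsAbsoluteHodgeClass.isWeaklyAbsoluteHodgeClass`).

In each case the conclusion `c ∈ algebraicClasses X 2 = N²H⁴` is weakened to divisor support
`N¹H⁴ = supportedClasses X 4 1` (`supportedClasses_mono`).  Ordering of the kernels (mathematics, not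
kernel-checked here): AH(4,2) ⟹ WAH(4,2) (proved, above) ⟹ [Voisin 2007 Thm. 0.5 (2) / Lemma 1.4:
the base of the Hodge-locus component of a weakly absolute class in a `ℚ̄`-family is defined over
`ℚ̄`; with Cattani–Deligne–Kaplan and "a `ℚ̄`-closed set through a `ℚ̄`-generic point is everything"]
⟹ T.  So the line's registered kernel T is the WEAKEST of the three, and the E-side inputs compare as
stmt-11596 (HC/`ℚ̄`, all codimensions, used by Voisin's fact as printed) ⊇ HC/`ℚ̄`(·,2) (the line's E,
`stub_qbarDivisorSupportCodimTwo_iff_hcQbarCodimTwo`) and stmt-1070 (HC over number fields = HC/`ℚ̄`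
with Hodge models).  Nothing here is a new definition or a new named fact.

References: C. Voisin, *Hodge loci and absolute Hodge classes*, Compositio Math. 143 (2007),
Def. 1.1, Def. 2.1, Prop. 1.2 (= Prop. 0.7 of arXiv:math/0605766), Thm. 0.5; F. Charles, C. Schnell,
*Notes on absolute Hodge classes* (2014), Def. 11.2.3, Thm. 11.3.19; P. Deligne, *Hodge cycles on
abelian varieties* (LNM 900, 1982), §2 (absolute Hodge cycles, Question 2.4).
-/

-- every declaration of this problem lives in `Summit.HodgeConjecture.HodgeConjecture.…`
set_option linter.dupNamespace false

noncomputable section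

namespace Summit.HodgeConjecture.HodgeConjecture.Theorems

open CategoryTheory AlgebraicGeometry
open Summit.HodgeConjecture.HodgeConjecture.Theses
open Literature.AlgebraicGeometry Literature.AlgebraicGeometry.Motives
open Literature.AlgebraicGeometry.HodgeTheory

/-- **stmt-2409 ⟸ AH(4,2) ∧ stmt-1070 ∧ stmt-15945 (items only).**  If every rational `(2,2)`-class on
every smooth projective complex fourfold is an absolute Hodge class (Deligne's question for fourfolds,
`IsAbsoluteHodgeClass 4 X 2 c`), then the Hodge conjecture over number fields
(`BoundaryReadout.HCOverNumberFields`, stmt-HodgeConjecture-1070) and Voisin's reduction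
(`BoundaryReadout.AbsoluteReduction`, stmt-HodgeConjecture-15945: HC over number fields ⟹ every
absolute Hodge class is algebraic — Voisin 2007 Prop. 1.2, theorem in print) make every such class
algebraic (`N²H⁴`), hence supported on a divisor (`N² ⊆ N¹`, `supportedClasses_mono`).
[cite: Voisin2007HodgeLoci, Prop. 1.2] [cite: CharlesSchnell2014Notes, Def. 11.2.3]
[cite: GrothendieckTopology1969, §1] -/
theorem linearSystemTorelli_middleDivisorSupportFourfold_of_absoluteHodge_of_absoluteReduction :
    (∀ ⦃X : SchemeOver ℂ⦄, IsSmoothProjective 4 X → ∀ c : complexBetti X 4, IsRationalClass c →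
      IsOfHodgeType 4 X 4 2 2 c → IsAbsoluteHodgeClass 4 X 2 c) →
    BoundaryReadout.HCOverNumberFields → BoundaryReadout.AbsoluteReduction →
    LinearSystemTorelli.MiddleDivisorSupportFourfold := by
  intro hAH hQ hR X hX c hc hh
  have halg : c ∈ algebraicClasses X 2 := (hR hQ hX).2 2 c (hAH hX c hc hh)
  exact supportedClasses_mono X 4 (by norm_num : 1 ≤ 2) halg

/-- **stmt-2409 ⟸ WAH(4,2) ∧ stmt-11596 modulo Voisin 2007 Prop. 1.2 (weakly-absolute reading).**
If every rational `(2,2)`-class on every smooth projective complex fourfold is WEAKLY absolute Hodge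
(Voisin 2007 Def. 2.1, `IsWeaklyAbsoluteHodgeClass 4 X 2 c`: each conjugate is the period twist times
an algebraic number times a rational `(2,2)`-class), then the named fact
`voisin2007_hodgeConjecture_weaklyAbsolute_of_qbar` (for a fixed `ι : ℚ̄ →+* ℂ`: HC for weakly
absolute classes on `ℚ̄`-varieties ⟹ HC for weakly absolute classes everywhere), fed with the Hodge
conjecture over `ℚ̄` (`PeriodDeficiency.HodgeConjectureQbar`, stmt-HodgeConjecture-11596, through
`mem_algebraicClasses_of_hodgeConjectureFor_of_isWeaklyAbsoluteHodgeClass`), makes every such class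
algebraic, hence supported on a divisor.  An embedding `ℚ̄ →+* ℂ` exists
(`exists_ringHom_algebraicClosure_rat_complex`). [cite: Voisin2007HodgeLoci, Prop. 1.2, Rem. 1.4 and Def. 2.1]
[cite: GrothendieckTopology1969, §1] -/
theorem linearSystemTorelli_middleDivisorSupportFourfold_of_weaklyAbsoluteHodge_of_voisin2007 :
    (∀ ⦃X : SchemeOver ℂ⦄, IsSmoothProjective 4 X → ∀ c : complexBetti X 4, IsRationalClass c →
      IsOfHodgeType 4 X 4 2 2 c → IsWeaklyAbsoluteHodgeClass 4 X 2 c) →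
    voisin2007_hodgeConjecture_weaklyAbsolute_of_qbar →
    PeriodDeficiency.HodgeConjectureQbar →
    LinearSystemTorelli.MiddleDivisorSupportFourfold := by
  intro hWAH hV hQ X hX c hc hh
  have halg : c ∈ algebraicClasses X 2 :=
    hodgeConjecture_weaklyAbsolute_of_hodgeConjectureFor_qbar hV (fun σ _ _ hX₀ ↦ hQ σ hX₀) hX
      (hWAH hX c hc hh)
  exact supportedClasses_mono X 4 (by norm_num : 1 ≤ 2) halg

/-- **stmt-2409 ⟸ AH(4,2) ∧ stmt-11596 modulo Voisin 2007 Prop. 1.2 (weakly-absolute reading)** —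
the absolute-Hodge hypothesis implies the weakly-absolute one
(`IsAbsoluteHodgeClass.isWeaklyAbsoluteHodgeClass`, `t = 1`), so the previous residue applies.
[cite: Voisin2007HodgeLoci, Def. 1.1, Def. 2.1 and Prop. 1.2] -/
theorem linearSystemTorelli_middleDivisorSupportFourfold_of_absoluteHodge_of_voisin2007 :
    (∀ ⦃X : SchemeOver ℂ⦄, IsSmoothProjective 4 X → ∀ c : complexBetti X 4, IsRationalClass c →
      IsOfHodgeType 4 X 4 2 2 c → IsAbsoluteHodgeClass 4 X 2 c) →
    voisin2007_hodgeConjecture_weaklyAbsolute_of_qbar →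
    PeriodDeficiency.HodgeConjectureQbar →
    LinearSystemTorelli.MiddleDivisorSupportFourfold :=
  fun hAH ↦ linearSystemTorelli_middleDivisorSupportFourfold_of_weaklyAbsoluteHodge_of_voisin2007
    fun _ hX c hc hh ↦ (hAH hX c hc hh).isWeaklyAbsoluteHodgeClass

end Summit.HodgeConjecture.HodgeConjecture.Theorems

end
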